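import Summits.Ventures.PercRepro.RankLevelSetExplicitLin2
import Summits.Ventures.PercRepro.RankLevelSetAC
import Summits.Ventures.PercRepro.RankLevelSetContractMonoLevel
import Summits.Ventures.PercRepro.S3SixWindowC
import Summits.Ventures.PercRepro.RankLevelSetLevelFourAll
import Summits.Ventures.PercRepro.RankLevelSetLevelSplitAll
import Summits.Ventures.PercRepro.RankLevelSetExplicitLinCells

/-!
# PercRepro — THEOREM U: C-025 AT EVERY LEVEL `q` FOR EVERY `p ≥ q·2^{q+1} + 1` (p9, S4)

`proofs/SUBCLAIM-S4-p9.md` §S4.2⁗′. THEOREM P⁗″ (`RankLevelSetExplicitLin2`) covers `q ≥ 7`; the rows `q ≤ 7` of the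
tree all lie below `q·2^{q+1} + 1` (`q = 0`: every `p`, Theorem A; `q = 1`: `3 ≤ 5`; `q = 2`: `4 ≤ 17`, Theorem N;
`q = 3`: `5 ≤ 49`; `q = 4`: `60 ≤ 129`; `q = 5`: `175 ≤ 321`; `q = 6`: `175 ≤ 769`; `q = 7`: `651 ≤ 1 793`), so ONE
statement holds at every level: for every finite matroid `M` and every `(p, q)` with `p ≥ q·2^{q+1} + 1`,
`Φ(p, q)·#{A : ρ(A) = p, ρ(E∖A) = q} ≤ #{A : q < ρ(A) < p}`. Consequences in the shape of the crux: `c025_of_window` (C-025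
follows from its finite windows `q + 2 ≤ p ≤ q·2^{q+1}`) and `c025_of_cells` (C-025 follows from the simple, coloop-free,
`e`-free core cells `(p, n)` with `q + 2 ≤ p ≤ q·2^{q+1}` and `n < Nexp p q`, `q ≥ 4` — night-1's finite reduction
`core_fixed_rank_of_le` with the new threshold). Axioms: standard.
-/

open scoped Matroid

namespace PercRepro

namespace ThmN

variable {α : Type}

/-- **THEOREM U — C-025 AT EVERY LEVEL `q` FOR EVERY FINITE MATROID AND EVERY `p ≥ q·2^{q+1} + 1`.** -/
theorem c025_uniform (q : ℕ) (M : Matroid α) [M.Finite] (p : ℕ) (hp : q * 2 ^ (q + 1) + 1 ≤ p) : RLS M p q := by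
  rcases Nat.lt_or_ge q 8 with h8 | h8
  · interval_cases q
    · exact c025_of_q_zero (M := M) p
    · exact c025_q_one_of_contractMono M p (by omega)
    · exact c025_two_all M p (by omega)
    · exact SevenThree.c025_three_all M p (by omega)
    · exact c025_four_large M p (by omega)
    · exact c025_five_large_split M p (by omega)
    · exact c025_six_large_one_seventy_five' M p (by omega)
    · exact c025_seven_large_mult4'' M p (by omega)
  · exact c025_lin2_seven_up q (by omega) M p hp

/-- THEOREM U in the literal `C025` body: `phiK p q · #{A : ρ(A) = p, ρ(E∖A) = q} ≤ #{A : q < ρ(A) < p}` whenever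
`p ≥ q·2^{q+1} + 1`. -/
theorem c025_uniform' (M : Matroid α) [M.Finite] (p q : ℕ) (hp : q * 2 ^ (q + 1) + 1 ≤ p) :
    phiK p q * ({A : Set α | A ⊆ M.E ∧ M.eRk A = (p : ℕ∞) ∧ M.eRk (M.E \ A) = (q : ℕ∞)}.ncard : ℚ) ≤
      ({A : Set α | A ⊆ M.E ∧ (q : ℕ∞) < M.eRk A ∧ M.eRk A < (p : ℕ∞)}.ncard : ℚ) :=
  c025_uniform q M p hp

/-- THEOREM U in the shape of the crux `C025` restricted to `p ≥ q·2^{q+1} + 1`: the only missing part of `C025` is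
the finite window `q + 2 ≤ p ≤ q·2^{q+1}` at each level `q ≥ 4`. -/
theorem c025_of_window :
    (∀ {α : Type} (M : Matroid α) [M.Finite] (p q : ℕ), q + 2 ≤ p → p ≤ q * 2 ^ (q + 1) →
      phiK p q * ({A : Set α | A ⊆ M.E ∧ M.eRk A = (p : ℕ∞) ∧ M.eRk (M.E \ A) = (q : ℕ∞)}.ncard : ℚ) ≤
        ({A : Set α | A ⊆ M.E ∧ (q : ℕ∞) < M.eRk A ∧ M.eRk A < (p : ℕ∞)}.ncard : ℚ)) → C025 := by
  intro hwin α M _ p q hpq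
  rcases Nat.lt_or_ge (q * 2 ^ (q + 1)) p with h | h
  · exact c025_uniform' M p q (by omega)
  · exact hwin M p q hpq h

/-- **THE CRUX IS ITS WINDOWS** (both directions): `C025` ⟺ the finite windows `q + 2 ≤ p ≤ q·2^{q+1}`. -/
theorem c025_iff_window :
    C025 ↔ (∀ {α : Type} (M : Matroid α) [M.Finite] (p q : ℕ), q + 2 ≤ p → p ≤ q * 2 ^ (q + 1) →
      phiK p q * ({A : Set α | A ⊆ M.E ∧ M.eRk A = (p : ℕ∞) ∧ M.eRk (M.E \ A) = (q : ℕ∞)}.ncard : ℚ) ≤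
        ({A : Set α | A ⊆ M.E ∧ (q : ℕ∞) < M.eRk A ∧ M.eRk A < (p : ℕ∞)}.ncard : ℚ)) :=
  ⟨fun h _ M _ p q hpq _ => h M p q hpq, c025_of_window⟩

/-- **Every level is a finite problem modulo the level below, with the threshold `q·2^{q+1}`**: level `q + 1`
for every `p ≥ q + 3` follows from level `q` (all `p ≥ q + 2`) and the simple, coloop-free, `e`-free core cells of rank
`q + 3 ≤ p ≤ (q+1)·2^{q+2}` on fewer than `Nexp p (q + 1)` elements (every `q`). -/
theorem finite_cells_level_succ_uniform (q : ℕ)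
    (hprev : ∀ (M : Matroid α) [M.Finite] (p : ℕ), q + 2 ≤ p → RLS M p q)
    (hcells : ∀ (M : Matroid α) [M.Finite] (p : ℕ), q + 3 ≤ p → p ≤ (q + 1) * 2 ^ (q + 2) →
      M.E.ncard < Nexp p (q + 1) →
      (∀ e ∈ M.E, ∀ f ∈ M.E, e ≠ f → M.eRk {e, f} = 2) → M.eRank = (p : ℕ∞) → (∀ e, ¬ M.IsColoop e) →
      (∀ e ∈ M.E, ∃ A ⊆ M.E \ {e}, e ∉ M.closure A ∧ e ∉ M.closure ((M.E \ {e}) \ A)) → RLS M p (q + 1)) :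
    ∀ (M : Matroid α) [M.Finite] (p : ℕ), q + 3 ≤ p → RLS M p (q + 1) := by
  refine rls_succ_all q hprev ?_
  intro M _ p hp hs hR hc hfree
  rcases Nat.lt_or_ge ((q + 1) * 2 ^ (q + 2)) p with hpP | hpP
  · exact c025_uniform (q + 1) M p (by rw [show q + 1 + 1 = q + 2 from rfl]; omega)
  · rcases Nat.lt_or_ge M.E.ncard (Nexp p (q + 1)) with hn | hn
    · exact hcells M p hp hpP hn hs hR hc hfree
    · exact core_fixed_rank_of_le p (q + 1) (by omega) M hn hfree

/-- **THE GAP OF EVERY LEVEL IS AN EXPLICIT FINITE LIST OF CORE CELLS, WITH THE THRESHOLD `q·2^{q+1}`**: if every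
simple, coloop-free, `e`-free core cell `(p, n)` of every level `4 ≤ q′ ≤ q` with `q′ + 2 ≤ p ≤ q′·2^{q′+1}` and
`n < Nexp p q′` satisfies C-025 at level `q′`, then C-025 holds at level `q` for every finite matroid and every `p ≥ q + 2`. -/
theorem c025_level_of_cells_uniform (q : ℕ) (hq : 3 ≤ q)
    (hcells : ∀ q', 4 ≤ q' → q' ≤ q → ∀ (M : Matroid α) [M.Finite] (p : ℕ), q' + 2 ≤ p → p ≤ q' * 2 ^ (q' + 1) →
      M.E.ncard < Nexp p q' → (∀ e ∈ M.E, ∀ f ∈ M.E, e ≠ f → M.eRk {e, f} = 2) → M.eRank = (p : ℕ∞) →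
      (∀ e, ¬ M.IsColoop e) →
      (∀ e ∈ M.E, ∃ A ⊆ M.E \ {e}, e ∉ M.closure A ∧ e ∉ M.closure ((M.E \ {e}) \ A)) → RLS M p q') :
    ∀ (M : Matroid α) [M.Finite] (p : ℕ), q + 2 ≤ p → RLS M p q := by
  induction q, hq using Nat.le_induction with
  | base =>
    intro M _ p hp
    exact SevenThree.c025_three_all M p hp
  | succ q hq ih =>
    have ih' := ih (fun q' h4 hq' => hcells q' h4 (by omega))
    intro M _ p hp
    exact finite_cells_level_succ_uniform q ih' (hcells (q + 1) (by omega) le_rfl) M p (by omega)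

/-- **THE CRUX REDUCED TO ITS CORE CELLS**: C-025 follows from the simple, coloop-free, `e`-free core cells `(p, n)`
with `q + 2 ≤ p ≤ q·2^{q+1}` and `n < Nexp p q` at every level `q ≥ 4` (the levels `q ≤ 3` are tree theorems). -/
theorem c025_of_cells
    (hcells : ∀ q, 4 ≤ q → ∀ {α : Type} (M : Matroid α) [M.Finite] (p : ℕ), q + 2 ≤ p → p ≤ q * 2 ^ (q + 1) →
      M.E.ncard < Nexp p q → (∀ e ∈ M.E, ∀ f ∈ M.E, e ≠ f → M.eRk {e, f} = 2) → M.eRank = (p : ℕ∞) →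
      (∀ e, ¬ M.IsColoop e) →
      (∀ e ∈ M.E, ∃ A ⊆ M.E \ {e}, e ∉ M.closure A ∧ e ∉ M.closure ((M.E \ {e}) \ A)) → RLS M p q) : C025 := by
  intro α M _ p q hpq
  rcases Nat.lt_or_ge q 3 with h3 | h3
  · interval_cases q
    · exact c025_of_q_zero (M := M) p
    · exact c025_q_one_of_contractMono M p hpq
    · exact c025_two_all M p hpq
  · exact c025_level_of_cells_uniform q h3 (fun q' h4 _ M _ p => hcells q' h4 M p) M p hpq

/-- Level `8` for `p ≥ 4 097` (THEOREM U; `q = 9`, `10` are `c025_lin2_nine` / `c025_lin2_ten`). -/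
theorem c025_uniform_eight (M : Matroid α) [M.Finite] (p : ℕ) (hp : 4097 ≤ p) : RLS M p 8 :=
  c025_uniform 8 M p (by norm_num; omega)

/-- Level `11` for `p ≥ 45 057` (THEOREM U; the first level with no per-corank ladder). -/
theorem c025_uniform_eleven (M : Matroid α) [M.Finite] (p : ℕ) (hp : 45057 ≤ p) : RLS M p 11 :=
  c025_uniform 11 M p (by norm_num; omega)

/-- Level `12` for `p ≥ 98 305` (THEOREM U). -/
theorem c025_uniform_twelve (M : Matroid α) [M.Finite] (p : ℕ) (hp : 98305 ≤ p) : RLS M p 12 :=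
  c025_uniform 12 M p (by norm_num; omega)

end ThmN

end PercRepro
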